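import Mathlib
import Summits.NavierStokesRegularity.NavierStokesRegularity.Theorems.FilamentSkeletonRssClause13PartitionKernels
import Summits.NavierStokesRegularity.NavierStokesRegularity.Theorems.FilamentSkeletonRssClause13CutoffCommutatorRefined
import Summits.NavierStokesRegularity.NavierStokesRegularity.Theorems.FilamentSkeletonRssClause13BandVirialTools

/-!
# Clause 13-J/13-R, brick n3 (PROFILE KERNELS, generic part): complex kernels of REAL Schwartz profiles, scaled kernels, and the transition profile

Route `FilamentSkeletonRss`, ∃-side clause 13 (`Clause13RNearStraightL` stmt-NavierStokesRegularity-23612; typing-agnostic); companion of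
`…Clause13PartitionKernels` (p698858, real EVEN profiles).  The model theorem `model_l2_estimate` needs (i) a ONE-SIDED band profile, whose kernel
`𝓕⁻ψ = a + ib` is complex with `a` even and `b` odd, (ii) kernels at the scales `x_s` and `X`, and (iii) the profile of the transition kernel `t·k′ + k`.
Generic tools for all three, for a real-valued `ψ ∈ 𝓢(ℝ, ℂ)`:
* §1 `fourierInv_neg_eq_conj` (`(𝓕⁻ψ)(−t) = conj (𝓕⁻ψ)(t)`), `reKernel_even`, `imKernel_odd`; `hasDerivAt_imKernel`, `continuous_imKernel`,
  `integrable_pow_mul_imKernel`; uniform bounds `abs_reKernel_le`, `abs_imKernel_le`, `abs_mul_reKernelDeriv_le`;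
* §2 `unnormalisedTransform_reIm` — `∫ a e^{izt} + i∫ b e^{izt} = ψ(−z/(2π))` for `a = Re 𝓕⁻ψ`, `b = Im 𝓕⁻ψ`;
* §3 scaled kernels `k_μ(t) = μ⁻¹k(t/μ)`: `unnormalisedTransform_scaledKernel` (`∫k_μ e^{izt} = ∫k e^{i(μz)u}`), `integrable_scaledKernel`,
  `integrable_mul_scaledKernel`, `integral_abs_deriv_scaledKernel` (`‖k_μ′‖₁ = μ⁻¹‖k′‖₁`);
* §4 the TRANSITION PROFILE `unnormalisedTransform_transitionKernel`: `∫(t k′ + k)e^{izt} = −z·F′(z)` whenever `∫k e^{izt} = F(z)` with `F′` the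
  derivative of `F` (differentiation under the integral = `hasDerivAt_unnormalisedTransform` of `…Clause13BandVirialTools`, p685720).
Lane ns-filament-19175-p1 g17; `--supports stmt-NavierStokesRegularity-23612 --as helper`.
HONEST FRAMING: Fourier bookkeeping attached to a HYPOTHETICAL filament skeleton's linearised operator on the NEGATIVE side of a MODEL route; nothing
here bears on Navier–Stokes regularity or blow-up.
-/

noncomputable section

open MeasureTheory Real Complex Filter Set
open scoped FourierTransform ComplexConjugate Topology

namespace Summit.NavierStokesRegularity.NavierStokesRegularity.Theorems.MatchedKernel
set_option linter.dupNamespace false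

/-! ## §1 Kernels of real profiles: parity, derivative, integrability, bounds -/

/-- For a real-valued Schwartz `ψ`: `(𝓕⁻ψ)(−t) = conj ((𝓕⁻ψ)(t))`. [folklore] -/
theorem fourierInv_neg_eq_conj (ψ : SchwartzMap ℝ ℂ) (hre : ∀ v, conj (ψ v) = ψ v) (t : ℝ) :
    (𝓕⁻ ψ : SchwartzMap ℝ ℂ) (-t) = conj ((𝓕⁻ ψ : SchwartzMap ℝ ℂ) t) := by
  have hcoe : ((𝓕⁻ ψ : SchwartzMap ℝ ℂ) : ℝ → ℂ) = 𝓕⁻ (ψ : ℝ → ℂ) := SchwartzMap.fourierInv_coe ψ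
  rw [show (𝓕⁻ ψ : SchwartzMap ℝ ℂ) (-t) = (𝓕⁻ (ψ : ℝ → ℂ)) (-t) from congrFun hcoe (-t),
    show (𝓕⁻ ψ : SchwartzMap ℝ ℂ) t = (𝓕⁻ (ψ : ℝ → ℂ)) t from congrFun hcoe t,
    Real.fourierInv_eq_fourier_neg, neg_neg, ← conj_fourier_eq_fourierInv hre t, Complex.conj_conj]

/-- `a = Re 𝓕⁻ψ` is even for real `ψ`. [folklore] -/
theorem reKernel_even (ψ : SchwartzMap ℝ ℂ) (hre : ∀ v, conj (ψ v) = ψ v) (t : ℝ) :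
    ((𝓕⁻ ψ : SchwartzMap ℝ ℂ) (-t)).re = ((𝓕⁻ ψ : SchwartzMap ℝ ℂ) t).re := by
  rw [fourierInv_neg_eq_conj ψ hre t, Complex.conj_re]

/-- `b = Im 𝓕⁻ψ` is odd for real `ψ`. [folklore] -/
theorem imKernel_odd (ψ : SchwartzMap ℝ ℂ) (hre : ∀ v, conj (ψ v) = ψ v) (t : ℝ) :
    ((𝓕⁻ ψ : SchwartzMap ℝ ℂ) (-t)).im = -((𝓕⁻ ψ : SchwartzMap ℝ ℂ) t).im := by
  rw [fourierInv_neg_eq_conj ψ hre t, Complex.conj_im]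

/-- `Im φ` has derivative `Im φ′`. [folklore] -/
theorem hasDerivAt_imKernel (φ : SchwartzMap ℝ ℂ) (t : ℝ) :
    HasDerivAt (fun s : ℝ => (φ s).im) ((SchwartzMap.derivCLM ℝ ℂ φ t).im) t := by
  have h := Complex.imCLM.hasFDerivAt.comp_hasDerivAt t (SchwartzMap.hasDerivAt φ t)
  rw [SchwartzMap.derivCLM_apply]
  exact h.congr_deriv (by simp)

/-- `Im φ` is continuous. [folklore] -/
theorem continuous_imKernel (φ : SchwartzMap ℝ ℂ) : Continuous fun s : ℝ => (φ s).im :=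
  Complex.continuous_im.comp φ.continuous

/-- `|t|^n · Im φ(t)` is integrable for a Schwartz `φ`. [folklore] -/
theorem integrable_pow_mul_imKernel (φ : SchwartzMap ℝ ℂ) (n : ℕ) : Integrable fun t : ℝ => t ^ n * (φ t).im := by
  have h := φ.integrable_pow_mul volume n
  refine h.mono' ?_ (Eventually.of_forall fun t => ?_)
  · exact ((continuous_id.pow n).mul (continuous_imKernel φ)).aestronglyMeasurable
  · rw [Real.norm_eq_abs, abs_mul, abs_pow, ← Real.norm_eq_abs]
    exact mul_le_mul_of_nonneg_left (Complex.abs_im_le_norm _) (by positivity)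

/-- Uniform bound `|Re φ(t)| ≤ p₀(φ)` (`p₀` the `(0,0)` Schwartz seminorm). [folklore] -/
theorem abs_reKernel_le (φ : SchwartzMap ℝ ℂ) (t : ℝ) : |(φ t).re| ≤ SchwartzMap.seminorm ℝ 0 0 φ :=
  (Complex.abs_re_le_norm _).trans (SchwartzMap.norm_le_seminorm ℝ φ t)

/-- Uniform bound `|Im φ(t)| ≤ p₀(φ)`. [folklore] -/
theorem abs_imKernel_le (φ : SchwartzMap ℝ ℂ) (t : ℝ) : |(φ t).im| ≤ SchwartzMap.seminorm ℝ 0 0 φ :=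
  (Complex.abs_im_le_norm _).trans (SchwartzMap.norm_le_seminorm ℝ φ t)

/-- Uniform bound `|t · Re φ(t)| ≤ p₁(φ)` (`p₁` the `(1,0)` Schwartz seminorm). [folklore] -/
theorem abs_mul_reKernel_le (φ : SchwartzMap ℝ ℂ) (t : ℝ) : |t * (φ t).re| ≤ SchwartzMap.seminorm ℝ 1 0 φ := by
  have h := SchwartzMap.norm_pow_mul_le_seminorm ℝ φ 1 t
  rw [pow_one, Real.norm_eq_abs] at h
  rw [abs_mul]
  exact (mul_le_mul_of_nonneg_left (Complex.abs_re_le_norm _) (abs_nonneg _)).trans h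

/-- Uniform bound `|t · Im φ(t)| ≤ p₁(φ)`. [folklore] -/
theorem abs_mul_imKernel_le (φ : SchwartzMap ℝ ℂ) (t : ℝ) : |t * (φ t).im| ≤ SchwartzMap.seminorm ℝ 1 0 φ := by
  have h := SchwartzMap.norm_pow_mul_le_seminorm ℝ φ 1 t
  rw [pow_one, Real.norm_eq_abs] at h
  rw [abs_mul]
  exact (mul_le_mul_of_nonneg_left (Complex.abs_im_le_norm _) (abs_nonneg _)).trans h

/-! ## §2 The transforms of `a = Re 𝓕⁻ψ` and `b = Im 𝓕⁻ψ` recombine to the profile -/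

/-- `t ↦ k(t)e^{izt}` is integrable for `k ∈ L¹` real. [folklore] -/
theorem integrable_ofReal_mul_cexp {k : ℝ → ℝ} (hk : Integrable k) (z : ℝ) :
    Integrable fun t : ℝ => ((k t : ℝ) : ℂ) * cexp (I * z * t) := by
  have he : ∀ t : ℝ, ‖cexp (I * z * t)‖ ≤ 1 := fun t => by
    rw [show I * (z : ℂ) * (t : ℂ) = ((z * t : ℝ) : ℂ) * I by push_cast; ring, Complex.norm_exp_ofReal_mul_I]
  have hem : AEStronglyMeasurable (fun t : ℝ => cexp (I * z * t)) volume :=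
    (Complex.continuous_exp.comp (continuous_const.mul Complex.continuous_ofReal)).aestronglyMeasurable
  exact hk.ofReal.mul_bdd hem (ae_of_all _ he)

/-- **`∫ a e^{izt} dt + i·∫ b e^{izt} dt = ψ(−z/(2π))`** for `a = Re 𝓕⁻ψ`, `b = Im 𝓕⁻ψ` (any Schwartz `ψ`). [folklore] -/
theorem unnormalisedTransform_reIm (ψ : SchwartzMap ℝ ℂ) (z : ℝ) :
    (∫ t : ℝ, ((((𝓕⁻ ψ : SchwartzMap ℝ ℂ) t).re : ℝ) : ℂ) * cexp (I * z * t))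
      + I * ∫ t : ℝ, ((((𝓕⁻ ψ : SchwartzMap ℝ ℂ) t).im : ℝ) : ℂ) * cexp (I * z * t) = ψ (-z / (2 * π)) := by
  have ha : Integrable fun t : ℝ => ((𝓕⁻ ψ : SchwartzMap ℝ ℂ) t).re := integrable_reKernel _
  have hb : Integrable fun t : ℝ => ((𝓕⁻ ψ : SchwartzMap ℝ ℂ) t).im := by
    simpa using integrable_pow_mul_imKernel (𝓕⁻ ψ : SchwartzMap ℝ ℂ) 0
  have hIa := integrable_ofReal_mul_cexp ha z
  have hIb := integrable_ofReal_mul_cexp hb z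
  rw [← integral_const_mul, ← integral_add hIa (hIb.const_mul I), ← unnormalisedTransform_fourierInv_schwartz ψ z]
  refine integral_congr_ae (ae_of_all _ fun t => ?_)
  dsimp only
  generalize (𝓕⁻ ψ : SchwartzMap ℝ ℂ) t = w
  have e : w = ((w.re : ℝ) : ℂ) + ((w.im : ℝ) : ℂ) * I := (Complex.re_add_im w).symm.trans (by ring)
  calc (((w.re : ℝ) : ℂ)) * cexp (I * z * t) + I * ((((w.im : ℝ) : ℂ)) * cexp (I * z * t))
      = (((w.re : ℝ) : ℂ) + ((w.im : ℝ) : ℂ) * I) * cexp (I * z * t) := by ring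
    _ = w * cexp (I * z * t) := by rw [← e]

/-! ## §3 Scaled kernels `k_μ(t) = μ⁻¹ k(t/μ)` -/

/-- **`∫ μ⁻¹k(t/μ)·e^{izt} dt = ∫ k(u)·e^{i(μz)u} du`** (`μ > 0`). [folklore] -/
theorem unnormalisedTransform_scaledKernel (k : ℝ → ℝ) {μ : ℝ} (hμ : 0 < μ) (z : ℝ) :
    ∫ t : ℝ, (((μ⁻¹ * k (t / μ) : ℝ)) : ℂ) * cexp (I * z * t) = ∫ u : ℝ, ((k u : ℝ) : ℂ) * cexp (I * (μ * z) * u) := by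
  have hμ0 : (μ : ℂ) ≠ 0 := by exact_mod_cast hμ.ne'
  set g : ℝ → ℂ := fun u => ((μ⁻¹ : ℝ) : ℂ) * (((k u : ℝ) : ℂ) * cexp (I * ((μ : ℂ) * (z : ℂ)) * u)) with hg
  have h := Measure.integral_comp_div g μ
  have e1 : (fun t : ℝ => (((μ⁻¹ * k (t / μ) : ℝ)) : ℂ) * cexp (I * z * t)) = fun t => g (t / μ) := by
    funext t
    simp only [hg]
    have harg : I * ((μ : ℂ) * (z : ℂ)) * ((t / μ : ℝ) : ℂ) = I * (z : ℂ) * (t : ℂ) := by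
      push_cast
      field_simp
    rw [harg]
    push_cast
    ring
  rw [e1, h]
  simp only [hg]
  rw [integral_const_mul, abs_of_pos hμ, Complex.real_smul, ← mul_assoc,
    show ((μ : ℝ) : ℂ) * ((μ⁻¹ : ℝ) : ℂ) = 1 by push_cast; field_simp, one_mul]

/-- `k ∈ L¹ ⟹ k_μ ∈ L¹`. [folklore] -/
theorem integrable_scaledKernel {k : ℝ → ℝ} (hk : Integrable k) {μ : ℝ} (hμ : 0 < μ) : Integrable fun t : ℝ => μ⁻¹ * k (t / μ) :=
  (hk.comp_div hμ.ne').const_mul _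

/-- `t·k ∈ L¹ ⟹ t·k_μ ∈ L¹` (`t·k_μ(t) = (t/μ)·k(t/μ)`). [folklore] -/
theorem integrable_mul_scaledKernel {k : ℝ → ℝ} (hk : Integrable fun t => t * k t) {μ : ℝ} (hμ : 0 < μ) :
    Integrable fun t : ℝ => t * (μ⁻¹ * k (t / μ)) := by
  refine (hk.comp_div hμ.ne').congr (ae_of_all _ fun t => ?_)
  show t / μ * k (t / μ) = t * (μ⁻¹ * k (t / μ))
  rw [div_eq_mul_inv]; ring

/-- `t²·k ∈ L¹ ⟹ t²·(μ⁻¹·k_μ-type) ∈ L¹`: `t²·μ⁻¹(μ⁻¹k(t/μ)) = (t/μ)²k(t/μ)`. [folklore] -/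
theorem integrable_sq_mul_scaledKernelDeriv {k : ℝ → ℝ} (hk : Integrable fun t => t ^ 2 * k t) {μ : ℝ} (hμ : 0 < μ) :
    Integrable fun t : ℝ => t ^ 2 * (μ⁻¹ * (μ⁻¹ * k (t / μ))) := by
  refine (hk.comp_div hμ.ne').congr (ae_of_all _ fun t => ?_)
  show (t / μ) ^ 2 * k (t / μ) = t ^ 2 * (μ⁻¹ * (μ⁻¹ * k (t / μ)))
  rw [div_eq_mul_inv]; ring

/-- `t·k ∈ L¹ ⟹ t·(μ⁻¹·k_μ-type) ∈ L¹` with the extra `μ⁻¹`: `t·μ⁻¹(μ⁻¹k(t/μ)) = μ⁻¹·((t/μ)k(t/μ))`. [folklore] -/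
theorem integrable_mul_scaledKernelDeriv {k : ℝ → ℝ} (hk : Integrable fun t => t * k t) {μ : ℝ} (hμ : 0 < μ) :
    Integrable fun t : ℝ => t * (μ⁻¹ * (μ⁻¹ * k (t / μ))) := by
  refine ((hk.comp_div hμ.ne').const_mul μ⁻¹).congr (ae_of_all _ fun t => ?_)
  show μ⁻¹ * (t / μ * k (t / μ)) = t * (μ⁻¹ * (μ⁻¹ * k (t / μ)))
  rw [div_eq_mul_inv]; ring

/-- `‖k_μ′‖₁ = μ⁻¹‖k′‖₁` for `k_μ′(t) = μ⁻²k′(t/μ)`. [folklore] -/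
theorem integral_abs_deriv_scaledKernel (k' : ℝ → ℝ) {μ : ℝ} (hμ : 0 < μ) :
    ∫ t, |μ⁻¹ * (μ⁻¹ * k' (t / μ))| = μ⁻¹ * ∫ t, |k' t| := by
  have h := Measure.integral_comp_div (fun s => μ⁻¹ * (μ⁻¹ * |k' s|)) μ
  calc ∫ t, |μ⁻¹ * (μ⁻¹ * k' (t / μ))| = ∫ t, μ⁻¹ * (μ⁻¹ * |k' (t / μ)|) := by
        refine integral_congr_ae (ae_of_all _ fun t => ?_)
        dsimp only
        rw [abs_mul, abs_mul, abs_of_pos (inv_pos.2 hμ)]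
    _ = |μ| • ∫ y, μ⁻¹ * (μ⁻¹ * |k' y|) := h
    _ = μ⁻¹ * ∫ t, |k' t| := by
        rw [integral_const_mul, integral_const_mul, abs_of_pos hμ, smul_eq_mul, ← mul_assoc, ← mul_assoc, mul_inv_cancel₀ hμ.ne', one_mul]

/-- Uniform bound of a scaled kernel: `|μ⁻¹k(t/μ)| ≤ μ⁻¹M`. [folklore] -/
theorem abs_scaledKernel_le {k : ℝ → ℝ} {M : ℝ} (hk : ∀ t, |k t| ≤ M) {μ : ℝ} (hμ : 0 < μ) (t : ℝ) : |μ⁻¹ * k (t / μ)| ≤ μ⁻¹ * M := by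
  rw [abs_mul, abs_of_pos (inv_pos.2 hμ)]
  exact mul_le_mul_of_nonneg_left (hk _) (inv_pos.2 hμ).le

/-! ## §4 The transition profile: `∫(t k′ + k)e^{izt} = −z·F′(z)` -/

/-- **THE TRANSITION PROFILE.**  `k` real differentiable with `k, t k, t k′ ∈ L¹`; if `∫ k e^{izt} dt = F(z)` for all `z` and `F` has
derivative `F′(z₀)` at `z₀`, then `∫ (t k′(t) + k(t)) e^{iz₀t} dt = −z₀·F′(z₀)`  (integration by parts in `t` + differentiation in `z`). [folklore] -/
theorem unnormalisedTransform_transitionKernel {k k' : ℝ → ℝ} (hk : ∀ t, HasDerivAt k (k' t) t) (hki : Integrable k)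
    (hk1 : Integrable fun t => t * k t) (hk'1 : Integrable fun t => t * k' t) {F : ℝ → ℂ} {F' : ℂ} {z₀ : ℝ}
    (hF : ∀ z : ℝ, ∫ t : ℝ, ((k t : ℝ) : ℂ) * cexp (I * z * t) = F z) (hF' : HasDerivAt F F' z₀) :
    ∫ t : ℝ, (((t * k' t + k t : ℝ)) : ℂ) * cexp (I * z₀ * t) = -(z₀ : ℂ) * F' := by
  -- (i) `F′ = i∫ t·k(t)e^{iz₀t}`
  have hxk : Integrable (fun x : ℝ => x • (((k x : ℝ)) : ℂ)) := by
    refine hk1.ofReal.congr (ae_of_all _ fun x => ?_)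
    show (((x * k x : ℝ)) : ℂ) = x • (((k x : ℝ)) : ℂ)
    rw [Complex.real_smul]; push_cast; ring
  have hD := hasDerivAt_unnormalisedTransform (f := fun t : ℝ => ((k t : ℝ) : ℂ)) hki.ofReal hxk z₀
  have hDF : HasDerivAt F (I * ∫ t : ℝ, ((t : ℂ) * ((k t : ℝ) : ℂ)) * cexp (I * z₀ * t)) z₀ := by
    refine hD.congr_of_eventuallyEq (Eventually.of_forall fun z => (hF z).symm)
  have hF'eq : F' = I * ∫ t : ℝ, ((t : ℂ) * ((k t : ℝ) : ℂ)) * cexp (I * z₀ * t) := hF'.unique hDF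
  -- (ii) integration by parts: `d/dt [t k(t) e^{iz₀t}] = k e + t k′ e + i z₀ t k e`
  have he : ∀ t : ℝ, ‖cexp (I * z₀ * t)‖ ≤ 1 := fun t => by
    rw [show I * (z₀ : ℂ) * (t : ℂ) = ((z₀ * t : ℝ) : ℂ) * I by push_cast; ring, Complex.norm_exp_ofReal_mul_I]
  have hem : AEStronglyMeasurable (fun t : ℝ => cexp (I * z₀ * t)) volume :=
    (Complex.continuous_exp.comp (continuous_const.mul Complex.continuous_ofReal)).aestronglyMeasurable
  have hexpd : ∀ t : ℝ, HasDerivAt (fun t : ℝ => cexp (I * z₀ * t)) (I * z₀ * cexp (I * z₀ * t)) t := by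
    intro t
    have h1 : HasDerivAt (fun t : ℝ => I * (z₀ : ℂ) * (t : ℂ)) (I * z₀) t := by
      simpa using (Complex.ofRealCLM.hasDerivAt (x := t)).const_mul (I * (z₀ : ℂ))
    exact ((Complex.hasDerivAt_exp (I * z₀ * t)).comp t h1).congr_deriv (by ring)
  have hprod : ∀ t : ℝ, HasDerivAt (fun t : ℝ => ((t * k t : ℝ) : ℂ) * cexp (I * z₀ * t))
      ((((k t + t * k' t : ℝ)) : ℂ) * cexp (I * z₀ * t) + ((t * k t : ℝ) : ℂ) * (I * z₀ * cexp (I * z₀ * t))) t := by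
    intro t
    have h1 : HasDerivAt (fun t : ℝ => t * k t) (1 * k t + t * k' t) t := (hasDerivAt_id t).mul (hk t)
    have h2 : HasDerivAt (fun t : ℝ => ((t * k t : ℝ) : ℂ)) (((k t + t * k' t : ℝ)) : ℂ) t := by
      have := h1.ofReal_comp; simpa using this
    exact h2.mul (hexpd t)
  have hI1 : Integrable fun t : ℝ => (((k t + t * k' t : ℝ)) : ℂ) * cexp (I * z₀ * t) := by
    have h : Integrable fun t : ℝ => k t + t * k' t := hki.add hk'1
    exact h.ofReal.mul_bdd hem (ae_of_all _ he)
  have hI2 : Integrable fun t : ℝ => ((t * k t : ℝ) : ℂ) * (I * z₀ * cexp (I * z₀ * t)) := by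
    have h := (integrable_ofReal_mul_cexp hk1 z₀).const_mul (I * z₀)
    refine h.congr (ae_of_all _ fun t => ?_)
    simp only; ring
  have hI0 : Integrable fun t : ℝ => ((t * k t : ℝ) : ℂ) * cexp (I * z₀ * t) := integrable_ofReal_mul_cexp hk1 z₀
  have hzero := integral_eq_zero_of_hasDerivAt_of_integrable hprod (hI1.add hI2) hI0
  rw [integral_add hI1 hI2] at hzero
  -- rewrite the second integral as `i z₀ ∫ t k e` and the target integrand
  have h2eq : ∫ t : ℝ, ((t * k t : ℝ) : ℂ) * (I * z₀ * cexp (I * z₀ * t)) = z₀ * (I * ∫ t : ℝ, ((t : ℂ) * ((k t : ℝ) : ℂ)) * cexp (I * z₀ * t)) := by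
    rw [← integral_const_mul, ← integral_const_mul]
    refine integral_congr_ae (ae_of_all _ fun t => ?_)
    push_cast; ring
  have h1eq : ∫ t : ℝ, (((k t + t * k' t : ℝ)) : ℂ) * cexp (I * z₀ * t) = ∫ t : ℝ, (((t * k' t + k t : ℝ)) : ℂ) * cexp (I * z₀ * t) := by
    refine integral_congr_ae (ae_of_all _ fun t => ?_); dsimp only; rw [add_comm (k t) (t * k' t)]
  rw [h2eq, h1eq, ← hF'eq] at hzero
  linear_combination hzero

end Summit.NavierStokesRegularity.NavierStokesRegularity.Theorems.MatchedKernel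

end
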